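import Literature.MathematicalPhysics.QuantumFieldTheory.Balaban1983to89.T4PathwiseCoupling
import Mathlib.Probability.Kernel.IonescuTulcea.Traj

/-!
# T⁴ pure Yang–Mills, NE1′ (O3b/H2) — the COUPLING OF THE BLOCK-SPIN TOWERS REALISED ON ONE PATH SPACE
# (`T4CouplingChain`): frame hypotheses and Doob–Lévy increments of `T4PathwiseCoupling` from explicit
# one-step fibre kernels (Ionescu–Tulcea)

HONEST FRAMING.  This file is a piece of MEASURE THEORY (kernel-checked folklore).  It concerns the finite-volume
T⁴ renormalisation-group tower of [Balaban1983to89] only through a DICTIONARY stated below; it asserts NO printed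
statement, proves NO estimate of the programme, and is NOT progress on the Clay Millennium problem (no infinite
volume, no mass gap, no reconstruction).  Every declaration is tagged [folklore].

CITATION HEADER.  Nothing in this file is cited from the manuscripts under audit; no Literature fact is introduced.
The only imports are the cell's own kernel-checked modules (`T4PathwiseCoupling`, `T4MeanChannel`) and Mathlib's
Ionescu–Tulcea construction (`Mathlib.Probability.Kernel.IonescuTulcea.Traj`: `ProbabilityTheory.Kernel.traj`,
`Kernel.partialTraj`, `Kernel.trajMeasure`, `Kernel.condExp_traj`, the filtration `MeasureTheory.Filtration.piLE`;
for §7 also the regular conditional distribution `ProbabilityTheory.condDistrib` and the uniqueness of projective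
limits `MeasureTheory.IsProjectiveLimit.unique`, both transitively imported).

## What this module does (item (A3) of the NE1′-P2 record `t4/T4-EST-NE1p-P2.md`)

`T4PathwiseCoupling` proved the pathwise-coupling ("martingale / Azuma–Freedman") reduction of the dressed
stability estimate NE1′ over an ABSTRACT frame: a finite measure `μ` on a space `Ω`, an antitone sequence of
σ-algebras `F : ℕ → MeasurableSpace Ω` (`hF : Antitone F`, `hFle : ∀ j, F j ≤ mΩ`), an `F 0`-measurable bounded
dressing observable `f`, and HYPOTHESIS SHAPES on the Doob–Lévy increments `incr μ F f i = μ[f ∣ F i] − μ[f ∣ F (i+1)]`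
(`IncrementBound`, `IncrementVarBound`, `IncrementVarProxy`).  Its header (A3) left OPEN the construction of that
frame from the actual tower: «the event-refined filtration / Markov-kernel realisation of ℝ∘T on labelled carriers».

Here the frame is CONSTRUCTED from one-step kernel data and the increments are IDENTIFIED:

* DATA.  Measurable carriers `X 0, X 1, X 2, …` and Markov kernels
  `κ b : Kernel (Π i : Iic b, X i) (X (b+1))` (`b : ℕ`), plus a finite measure `ν` on `X 0`.
  DICTIONARY (cell reading; nothing of it is used in the proofs): `X 0` = the ENDPOINT carrier (the effective
  unit-lattice configuration after the last renormalisation step, together with whatever label / large-field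
  geometry data the endpoint density is indexed by); `X b` = the configuration-and-label data `b` levels BELOW the
  endpoint; `κ b` = the ONE-STEP BACKWARD (FIBRE) LAW of the level-`b+1` data given all coarser levels `≤ b` — for a
  renormalisation step `ρ_{k+1}(ψ) ∝ ∫ 𝒯(ψ ∣ φ) ρ_k(φ) dφ` with a normalised averaging kernel `𝒯` this is the Bayes
  posterior of `φ` given `ψ` (Mathlib `ProbabilityTheory.posterior`, `compProd_posterior_eq_map_swap`, on standard Borel
  carriers), and its dependence on the whole coarser history is exactly what "labelled carriers / event-refined"
  asks for (the refinement events are coordinates of the `X b`).  `ν` = the (undressed, un-normalised) endpoint law.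
* PATH SPACE.  `Ω := Π b, X b` with the product σ-algebra and the law `μ := Kernel.trajMeasure ν κ`
  (Ionescu–Tulcea: endpoint distributed by `ν`, then level after level drawn from the fibre kernels).  BOTH runs —
  dressed and undressed — live on this one space: the undressed run is `μ`, the dressed run is `e^{t f}·μ`
  (up to normalisation), and every endpoint observable is a function of the coordinate `x 0`.  This is the coupling.
* FRAME.  For a tower of depth `n` the frame filtration is `frameFiltration X n i := piLE (n − i)` (the σ-algebra of
  the levels `≤ n − i` below the endpoint): PROVED antitone (`antitone_frameFiltration`), below the product σ-algebra
  (`frameFiltration_le`), with `F 0 = piLE n ∋` every depth-`n` observable and `F n = piLE 0 ∋` every endpoint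
  observable (`stronglyMeasurable_endpoint`).  These discharge the binders `hF`, `hFle`, `hf0`, `hg` of EVERY theorem of
  `T4PathwiseCoupling` (§§2–6 there).
* CONDITIONAL EXPECTATIONS ARE EXPLICIT (`condExp_piLE_ae_eq`, from Mathlib's `condExp_traj` extended to the mixture
  over the endpoint): `μ[φ ∣ piLE b] = fiberMean κ b φ ∘ frestrictLe b` a.e., where
  `fiberMean κ b φ h := ∫ φ d(traj κ b h)` is the mean of `φ` over the sub-tower hanging below the history `h`.
* INCREMENTS ARE ONE-STEP FLUCTUATIONS (`incr_frame_ae_eq`): at frame index `i < n`, with `b := n − (i+1)`,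
  `incr μ F φ i = fiberMean κ (b+1) φ (x≤b+1) − fiberMean κ b φ (x≤b)` a.e., and (`fiberMean_eq_integral_partialTraj`)
  `fiberMean κ b φ h = ∫ fiberMean κ (b+1) φ d(partialTraj κ b (b+1) h)` — the increment is the fluctuation of the
  level-`(b+1)` fibre mean under the ONE explicit kernel `κ b`.
* THE CONDITIONAL VARIANCE IS THE ONE-STEP VARIANCE (`condExp_incr_sq_frame_ae_eq`):
  `μ[(incr μ F φ i)² ∣ F (i+1)] = oneStepVar κ b φ ∘ frestrictLe b` a.e.,
  `oneStepVar κ b φ h := ∫ (fiberMean κ (b+1) φ u − fiberMean κ b φ h)² d(partialTraj κ b (b+1) h)(u)`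
  (measurable in `h`: `stronglyMeasurable_oneStepVar`; frozen form `oneStepVar_eq_integral_traj`; `≤ (2R)²`:
  `oneStepVar_le`; and `oneStepVar_le_sq_of_osc`: a SUP-OSCILLATION bound `σ` on the one-step move of the fibre
  mean over the extensions of `h` gives `oneStepVar κ b φ h ≤ σ²`).
* DISCHARGE OF THE HYPOTHESIS SHAPES from PER-HISTORY kernel data:
  `incrementVarProxy_of_oneStepVar` (`oneStepVar κ b φ ≤ W b` pointwise ⇒ `IncrementVarProxy μ F φ n V` with the
  predictable proxies `V i := W (n−(i+1)) ∘ frestrictLe (n−(i+1))`, measurable one level up: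
  `stronglyMeasurable_frameProxy`), `incrementVarBound_of_oneStepVar` (constants), `incrementVarProxy_of_oneStepOsc`
  (per-history sup-oscillations `s b (u≤b)` ⇒ proxies `s²`), `incrementBound_of_oneStepOsc` (sup-oscillation of
  the fibre means ⇒ `IncrementBound`).
* ENDPOINT IDENTITIES: `integral_endpoint_eq` (functions of the endpoint integrate against `ν`),
  `condExp_endpoint_ae_eq_towerMean` (`μ[φ ∣ endpoint] = towerMean κ φ (x 0)` a.e.),
  `integral_mul_exp_eq_integral_towerMGF` (COUPLING IDENTITY IN KERNEL FORM: the dressed law of the endpoint is `ν`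
  reweighted by the tower moment-generating function `towerMGF κ φ t z = ∫ e^{tφ} d(traj κ 0 z)`), and the END-TO-END
  specialisation `integral_mul_exp_le_of_oneStepVar` of `T4PathwiseCoupling.integral_mul_exp_le_of_varProxy`:
  `∫ g(x 0) e^{tφ} dμ ≤ e^{t²B} ∫ g(z) e^{t·towerMean κ φ z} dν(z) + e^{|t|R}·Cg·μ{B < Σ_{b<n} W b (x≤b)}`,
  every constant explicit, NO dependence on the abstract frame left; and its sharpest instance
  `integral_mul_exp_le_condVar` with the EXACT conditional variances `W b := oneStepVar κ b φ` as proxies (tail event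
  `{B < Σ_{b<n} oneStepVar κ b φ (x≤b)}`).
* MARKOV-KERNEL REALISATION PROPERTY for finite `ν` (`map_frestrictLe_succ_eq_compProd`): the conditional law of
  level `b+1` given the levels `≤ b` under `μ` is `κ b` — the defining property of the realisation; and the
  one-step recursion of the history laws (`map_frestrictLe_succ_eq_partialTraj_comp`).

* (v2, §7) THE POSTERIOR-KERNEL PRESENTATION — NO REALISATION HYPOTHESIS IS LEFT: for standard Borel, non-empty
  carriers, EVERY finite measure `μ` on the path space `Π n, X n` IS the realised tower of its endpoint law and its
  POSTERIOR ONE-STEP KERNELS `posteriorKernel μ b := condDistrib (x ↦ x (b+1)) (x ↦ x≤b) μ` (the regular conditional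
  law of level `b+1` given the history `x≤b`; Mathlib's disintegration): `trajMeasure (μ.map (· 0)) (posteriorKernel μ)
  = μ` (`trajMeasure_posteriorKernel_eq`: the history laws agree for every length by the common one-step recursion
  `law(x≤b+1) = (law(x≤b) ⊗ κ b).map succGlue` — `map_frestrictLe_compProd_posteriorKernel` on the `μ` side,
  `map_frestrictLe_succ_eq_compProd` on the tower side — then uniqueness of projective limits of finite measures,
  Mathlib `IsProjectiveLimit.unique`).  Hence §§3–6 hold for an ARBITRARY finite path law with `κ := posteriorKernel μ`:
  `condExp_piLE_ae_eq_fiberMean_posteriorKernel` (`μ[φ ∣ piLE b] = fiberMean (posteriorKernel μ) b φ (x≤b)` a.e.),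
  `condExp_endpoint_ae_eq_towerMean_posteriorKernel`, `incr_frame_ae_eq_posteriorKernel`,
  `condExp_incr_sq_frame_ae_eq_posteriorKernel`, and the END-TO-END bounds `integral_mul_exp_le_condVar_of_pathLaw` /
  `integral_mul_exp_le_of_oneStepVar_of_pathLaw`, stated over `μ` alone.  For the lineage this means: the undressed law
  of the printed chain on its labelled level carriers (finite products of a compact metrisable group and finite label
  sets — standard Borel) needs NO construction to enter the frame; presenting it backward from the unit lattice, its
  one-step backward laws ARE `posteriorKernel μ b` (Bayes), and the fluctuation half of NE1′ is literally a
  `μ`-uniform tail bound for `Σ_{b<K} oneStepVar (posteriorKernel μ) b φ (x≤b)` (record MI-F1-K).  Nothing of the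
  printed form of these kernels is asserted.

## What this turns the lineage's missing inequality (MI-F1) into

The binder `hVdom` of `T4PathwiseCoupling.integral_mul_exp_le_uniform_of_nesting(_add)` asks for an a.e. domination
of abstract proxies `V i`.  After this module it is a statement about ONE EXPLICIT KERNEL PER LEVEL, pointwise in
the coarser history `h` (MI-F1-K, typed in the record v1.9): EITHER a variance bound
`oneStepVar κ b φ h ≤ C²·(θ²)^{lvl b}·κ₀^{N_irr(h)} + U_b(h)` (consumed by `incrementVarProxy_of_oneStepVar`), OR a
sup-oscillation bound `|fiberMean κ (b+1) φ u − fiberMean κ b φ (u≤b)| ≤ s b (u≤b)` (consumed by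
`incrementVarProxy_of_oneStepOsc`), OR directly a tail bound for the accumulated exact conditional variances
`μ{B < Σ_{b<n} oneStepVar κ b φ (x≤b)}` (consumed by `integral_mul_exp_le_condVar`) — in each case a statement
about the variation, under the one-step fibre law `κ b h`, of the conditional mean of the dressing observable over
the sub-tower, which is the quantity the printed analyticity / localisation estimates of the effective densities
speak about.  NOT proved here (it is the programme's content: NE1a's analyticity-domain match, (B)-currency
large-field probabilities); (A4) was closed by the companion `T4PathwiseCouplingComplex`.  Dead ends of the lineage
are not re-walked (record §6).
-/

open MeasureTheory ProbabilityTheory Finset Preorder Function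
open scoped ProbabilityTheory ENNReal

namespace Literature.MathematicalPhysics.QuantumFieldTheory.Balaban1983to89.T4CouplingChain

open MeasureTheory.Filtration
open Literature.MathematicalPhysics.QuantumFieldTheory.Balaban1983to89.T4MeanChannel
open Literature.MathematicalPhysics.QuantumFieldTheory.Balaban1983to89.T4PathwiseCoupling

noncomputable section

variable {X : ℕ → Type*} [∀ n, MeasurableSpace (X n)]

/-! ## §1  The frame filtration of a tower of depth `n` -/

section Frame

/-- [folklore] The FRAME FILTRATION of a tower of depth `n` on the path space `Π b, X b` (level `0` = endpoint):
`frameFiltration X n i` is the σ-algebra generated by the levels `≤ n − i`, i.e. Mathlib's `piLE (n − i)`.  Frame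
index `i` counts renormalisation steps towards the endpoint; `F 0 = piLE n` (everything down to depth `n`),
`F n = piLE 0` (the endpoint alone). -/
@[reducible] def frameFiltration (X : ℕ → Type*) [∀ n, MeasurableSpace (X n)] (n : ℕ) : ℕ → MeasurableSpace (Π b, X b) :=
  fun i => piLE (X := X) (n - i)

/-- [folklore] -/
theorem frameFiltration_apply (n i : ℕ) : frameFiltration X n i = piLE (X := X) (n - i) := rfl

/-- [folklore] -/
theorem frameFiltration_zero (n : ℕ) : frameFiltration X n 0 = piLE (X := X) n := rfl

/-- [folklore] -/
theorem frameFiltration_self (n : ℕ) : frameFiltration X n n = piLE (X := X) 0 := by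
  simp [frameFiltration]

/-- [folklore] For `i < n` the frame levels `i`, `i+1` are the chain levels `b+1`, `b` with `b = n − (i+1)`. -/
theorem frameFiltration_eq_succ {n i : ℕ} (hi : i < n) :
    frameFiltration X n i = piLE (X := X) (n - (i + 1) + 1) := by
  have h : n - i = n - (i + 1) + 1 := by omega
  simp only [frameFiltration, h]

/-- [folklore] **The frame filtration is antitone** (binder `hF` of `T4PathwiseCoupling`). -/
theorem antitone_frameFiltration (n : ℕ) : Antitone (frameFiltration X n) := by
  intro i j hij
  exact (piLE (X := X)).mono (Nat.sub_le_sub_left hij n)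

/-- [folklore] **Every frame level is a sub-σ-algebra of the product σ-algebra** (binder `hFle`). -/
theorem frameFiltration_le (n j : ℕ) :
    frameFiltration X n j ≤ (MeasurableSpace.pi : MeasurableSpace (Π b, X b)) :=
  (piLE (X := X)).le _

/-- [folklore] The restriction to the levels `≤ b` is `piLE b`-measurable. -/
theorem measurable_frestrictLe_piLE (b : ℕ) :
    Measurable[piLE (X := X) b] (frestrictLe (π := X) b) := by
  rw [piLE_eq_comap_frestrictLe]
  exact comap_measurable _

/-- [folklore] A function of the levels `≤ b` is `piLE b`-(strongly) measurable. -/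
theorem stronglyMeasurable_comp_frestrictLe {β : Type*} [TopologicalSpace β] {b : ℕ}
    {ψ : (Π i : Iic b, X i) → β} (hψ : StronglyMeasurable ψ) :
    StronglyMeasurable[piLE (X := X) b] (fun x : Π k, X k => ψ (frestrictLe b x)) :=
  hψ.comp_measurable (measurable_frestrictLe_piLE b)

/-- [folklore] A single coordinate `x k`, `k ≤ b`, is `piLE b`-measurable. -/
theorem measurable_eval_piLE {b k : ℕ} (hk : k ≤ b) :
    Measurable[piLE (X := X) b] (fun x : Π m, X m => x k) := by
  have h : (fun x : Π m, X m => x k) =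
      (fun y : Π i : Iic b, X i => y ⟨k, mem_Iic.2 hk⟩) ∘ frestrictLe (π := X) b := rfl
  rw [h]
  exact (measurable_pi_apply _).comp (measurable_frestrictLe_piLE b)

/-- [folklore] **Depth-`n` observables are `F 0`-measurable** (binder `hf0`): a `piLE n`-strongly-measurable `φ`. -/
theorem stronglyMeasurable_frame_zero {n : ℕ} {φ : (Π k, X k) → ℝ}
    (hφ : StronglyMeasurable[piLE (X := X) n] φ) : StronglyMeasurable[frameFiltration X n 0] φ := hφ

/-- [folklore] An observable attached at level `k ≤ n` (a measurable function of the coordinate `x k`) is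
`F 0`-measurable. -/
theorem stronglyMeasurable_frame_zero_of_level {n k : ℕ} (hk : k ≤ n) {f₀ : X k → ℝ}
    (hf₀ : StronglyMeasurable f₀) :
    StronglyMeasurable[frameFiltration X n 0] (fun x : Π m, X m => f₀ (x k)) :=
  hf₀.comp_measurable (measurable_eval_piLE hk)

/-- [folklore] **Endpoint observables are measurable at EVERY frame level** (binder `hg` with `F n`, and the
`F (i+1)`-measurability of endpoint-dependent proxies). -/
theorem stronglyMeasurable_endpoint {β : Type*} [TopologicalSpace β] {g₀ : X 0 → β}
    (hg : StronglyMeasurable g₀) (n i : ℕ) :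
    StronglyMeasurable[frameFiltration X n i] (fun x : Π k, X k => g₀ (x 0)) :=
  hg.comp_measurable (measurable_eval_piLE (Nat.zero_le _))

/-- [folklore] **Predictable proxies**: a measurable function of the history `≤ n − (i+1)` is
`F (i+1)`-measurable (binder `hVm`). -/
theorem stronglyMeasurable_frameProxy {W : (b : ℕ) → (Π i : Iic b, X i) → ℝ}
    (hWm : ∀ b, StronglyMeasurable (W b)) (n i : ℕ) :
    StronglyMeasurable[frameFiltration X n (i + 1)]
      (fun x : Π k, X k => W (n - (i + 1)) (frestrictLe (n - (i + 1)) x)) :=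
  stronglyMeasurable_comp_frestrictLe (hWm _)

end Frame

/-! ## §2  Bounded observables: integrability helpers -/

section Bounded

variable {α : Type*} {mα : MeasurableSpace α}

/-- [folklore] -/
theorem integrable_of_abs_le_const {μ : Measure α} [IsFiniteMeasure μ] {φ : α → ℝ}
    (hφm : StronglyMeasurable φ) {R : ℝ} (hφR : ∀ x, |φ x| ≤ R) : Integrable φ μ :=
  integrable_of_ae_abs_le hφm.aestronglyMeasurable (ae_of_all μ hφR)

/-- [folklore] -/
theorem abs_integral_le_of_abs_le_const {μ : Measure α} [IsProbabilityMeasure μ] {φ : α → ℝ}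
    (hφm : AEStronglyMeasurable φ μ) {R : ℝ} (hφR : ∀ x, |φ x| ≤ R) : |∫ x, φ x ∂μ| ≤ R := by
  have hi : Integrable φ μ := integrable_of_ae_abs_le hφm (ae_of_all μ hφR)
  calc |∫ x, φ x ∂μ| ≤ ∫ x, |φ x| ∂μ := abs_integral_le_integral_abs
    _ ≤ ∫ _, R ∂μ := integral_mono hi.abs (integrable_const R) hφR
    _ = R := by simp

end Bounded

/-! ## §3  The path law of the tower and its conditional expectations -/

section Chain

variable {κ : (b : ℕ) → Kernel (Π i : Iic b, X i) (X (b + 1))} [∀ b, IsMarkovKernel (κ b)]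

/-- [folklore] For a FINITE endpoint law `ν` the path law `trajMeasure ν κ` is finite (Mathlib registers only the
probability case; the cell's undressed endpoint law is an un-normalised density). -/
instance isFiniteMeasure_trajMeasure (ν : Measure (X 0)) [IsFiniteMeasure ν] :
    IsFiniteMeasure (Kernel.trajMeasure ν κ) := by
  refine ⟨?_⟩
  rw [Kernel.trajMeasure, Measure.comp_apply_univ]
  exact (Measure.map_apply (MeasurableEquiv.measurable _) MeasurableSet.univ).trans_lt (measure_lt_top ν _)

/-- [folklore] **Chain structure at level `b`.**  The path law is the Ionescu–Tulcea kernel from level `b` composed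
with its own level-`≤ b` marginal: `μ = traj κ b ∘ₘ μ.map (frestrictLe b)`. -/
theorem trajMeasure_eq_traj_comp (ν : Measure (X 0)) (b : ℕ) :
    Kernel.trajMeasure ν κ =
      (Kernel.traj κ b) ∘ₘ ((Kernel.trajMeasure ν κ).map (frestrictLe b)) := by
  rw [Kernel.trajMeasure, Measure.map_comp _ _ (measurable_frestrictLe b), Kernel.traj_map_frestrictLe,
    Measure.comp_assoc, Kernel.traj_comp_partialTraj (Nat.zero_le b)]

/-- [folklore] Set integrals against a composition `η ∘ₘ ρ`. -/
theorem setIntegral_comp_measure {α β : Type*} {mα : MeasurableSpace α} {mβ : MeasurableSpace β}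
    {η : Kernel α β} {ρ : Measure α} {G : β → ℝ} {s : Set β}
    (hs : MeasurableSet s) (hG : IntegrableOn G s (η ∘ₘ ρ)) :
    ∫ x in s, G x ∂(η ∘ₘ ρ) = ∫ a, ∫ x in s, G x ∂(η a) ∂ρ := by
  rw [Measure.comp_eq_comp_const_apply] at hG ⊢
  rw [Kernel.setIntegral_comp hs hG, Kernel.const_apply]

/-- [folklore] **CONDITIONAL EXPECTATION GIVEN THE LEVELS `≤ b` — general mixtures.**  For ANY finite measure `ρ` on
histories of length `b` and `μ := traj κ b ∘ₘ ρ`, `μ[φ ∣ piLE b] = (h ↦ ∫ φ d(traj κ b h)) ∘ frestrictLe b` a.e.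
(Mathlib's `condExp_traj` is the case `ρ = δ_{x₀}`; the proof integrates that case over `ρ` through the defining
set-integral property.) -/
theorem condExp_traj_comp {b : ℕ} {ρ : Measure (Π i : Iic b, X i)} [IsFiniteMeasure ρ]
    {φ : (Π n, X n) → ℝ} (hφ : Integrable φ ((Kernel.traj κ b) ∘ₘ ρ)) :
    ((Kernel.traj κ b) ∘ₘ ρ)[φ | piLE (X := X) b] =ᵐ[(Kernel.traj κ b) ∘ₘ ρ]
      fun x => ∫ y, φ y ∂(Kernel.traj κ b (frestrictLe b x)) := by
  have hmap : ((Kernel.traj κ b) ∘ₘ ρ).map (frestrictLe b) = ρ := by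
    rw [Measure.map_comp _ _ (measurable_frestrictLe b), Kernel.traj_map_frestrictLe,
      Kernel.partialTraj_self, Measure.id_comp]
  -- integrability of the fibre means
  have hψ : Integrable (fun h => ∫ y, φ y ∂(Kernel.traj κ b h)) ρ := by
    have h1 := hφ
    rw [Measure.comp_eq_comp_const_apply] at h1
    have h2 := h1.integral_comp
    rwa [Kernel.const_apply] at h2
  have hψ' : Integrable (fun h => ∫ y, φ y ∂(Kernel.traj κ b h))
      (((Kernel.traj κ b) ∘ₘ ρ).map (frestrictLe b)) := by
    rwa [hmap]
  have hψμ : Integrable (fun x => ∫ y, φ y ∂(Kernel.traj κ b (frestrictLe b x))) ((Kernel.traj κ b) ∘ₘ ρ) :=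
    hψ'.comp_measurable (measurable_frestrictLe b)
  -- ρ-a.e. the integrand is integrable for the fibre law, and there Mathlib's pointwise formula applies
  have hae : ∀ᵐ h ∂ρ, Integrable φ (Kernel.traj κ b h) := Measure.ae_integrable_of_integrable_comp hφ
  refine (ae_eq_condExp_of_forall_setIntegral_eq ((piLE (X := X)).le b) hφ
    (fun s _ _ => hψμ.integrableOn) ?_ ?_).symm
  · intro s hs _
    have hs' : MeasurableSet s := (piLE (X := X)).le b s hs
    rw [setIntegral_comp_measure hs' hψμ.integrableOn, setIntegral_comp_measure hs' hφ.integrableOn]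
    refine integral_congr_ae ?_
    filter_upwards [hae] with h hh
    -- on the fibre of `h`: Mathlib's `condExp_traj` and the set-integral property of `condExp`
    have hce := Kernel.condExp_traj (le_refl b) (x₀ := h) hh
    rw [← setIntegral_condExp ((piLE (X := X)).le b) hh hs]
    exact setIntegral_congr_ae hs' (hce.mono fun x hx _ => hx.symm)
  · rw [piLE_eq_comap_frestrictLe]
    exact hψ'.1.comp_ae_measurable' (measurable_frestrictLe b).aemeasurable

/-- [folklore] The FIBRE MEAN at depth `b`: the mean of a path observable over the sub-tower hanging below the
history `h` (levels `≤ b` frozen at `h`, the deeper levels drawn from the fibre kernels). -/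
def fiberMean (κ : (b : ℕ) → Kernel (Π i : Iic b, X i) (X (b + 1))) [∀ b, IsMarkovKernel (κ b)]
    (b : ℕ) (φ : (Π n, X n) → ℝ) (h : Π i : Iic b, X i) : ℝ :=
  ∫ y, φ y ∂(Kernel.traj κ b h)

/-- [folklore] -/
theorem fiberMean_apply (b : ℕ) (φ : (Π n, X n) → ℝ) (h : Π i : Iic b, X i) :
    fiberMean κ b φ h = ∫ y, φ y ∂(Kernel.traj κ b h) := rfl

/-- [folklore] Fibre means of measurable observables are measurable in the history. -/
theorem stronglyMeasurable_fiberMean (b : ℕ) {φ : (Π n, X n) → ℝ} (hφ : StronglyMeasurable φ) :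
    StronglyMeasurable (fiberMean κ b φ) :=
  StronglyMeasurable.integral_kernel (κ := Kernel.traj κ b) hφ

/-- [folklore] Fibre means of an observable bounded by `R` are bounded by `R`. -/
theorem abs_fiberMean_le (b : ℕ) {φ : (Π n, X n) → ℝ} (hφm : StronglyMeasurable φ) {R : ℝ}
    (hφR : ∀ x, |φ x| ≤ R) (h : Π i : Iic b, X i) : |fiberMean κ b φ h| ≤ R :=
  abs_integral_le_of_abs_le_const hφm.aestronglyMeasurable hφR

/-- [folklore] **CONDITIONAL EXPECTATIONS UNDER THE PATH LAW ARE FIBRE MEANS.**  For a finite endpoint law `ν` and an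
integrable path observable `φ`: `(trajMeasure ν κ)[φ ∣ piLE b] = fiberMean κ b φ ∘ frestrictLe b` a.e. -/
theorem condExp_piLE_ae_eq (ν : Measure (X 0)) [IsFiniteMeasure ν] (b : ℕ) {φ : (Π n, X n) → ℝ}
    (hφ : Integrable φ (Kernel.trajMeasure ν κ)) :
    (Kernel.trajMeasure ν κ)[φ | piLE (X := X) b] =ᵐ[Kernel.trajMeasure ν κ]
      fun x => fiberMean κ b φ (frestrictLe b x) := by
  set ρ := (Kernel.trajMeasure ν κ).map (frestrictLe b) with hρ
  have h := trajMeasure_eq_traj_comp (κ := κ) ν b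
  rw [← hρ] at h
  have hφ' : Integrable φ ((Kernel.traj κ b) ∘ₘ ρ) := by rwa [← h]
  rw [h]
  exact condExp_traj_comp hφ'

/-- [folklore] **ONE-STEP RECURSION OF THE FIBRE MEANS**: `fiberMean κ b φ h = ∫ fiberMean κ (b+1) φ d(partialTraj κ b
(b+1) h)` — the depth-`b` mean is the average of the depth-`(b+1)` means over ONE draw from the fibre kernel `κ b`. -/
theorem fiberMean_eq_integral_partialTraj (b : ℕ) {φ : (Π n, X n) → ℝ} (hφm : StronglyMeasurable φ) {R : ℝ}
    (hφR : ∀ x, |φ x| ≤ R) (h : Π i : Iic b, X i) :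
    fiberMean κ b φ h = ∫ u, fiberMean κ (b + 1) φ u ∂(Kernel.partialTraj κ b (b + 1) h) :=
  (Kernel.integral_traj_partialTraj (Nat.le_succ b) (integrable_of_abs_le_const hφm hφR)).symm

/-- [folklore] The ONE-STEP CONDITIONAL VARIANCE of the fibre means: the variance of `fiberMean κ (b+1) φ` under one
draw from the fibre kernel `κ b` at history `h` (its mean there being `fiberMean κ b φ h`). -/
def oneStepVar (κ : (b : ℕ) → Kernel (Π i : Iic b, X i) (X (b + 1))) [∀ b, IsMarkovKernel (κ b)]
    (b : ℕ) (φ : (Π n, X n) → ℝ) (h : Π i : Iic b, X i) : ℝ :=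
  ∫ u, (fiberMean κ (b + 1) φ u - fiberMean κ b φ h) ^ 2 ∂(Kernel.partialTraj κ b (b + 1) h)

/-- [folklore] -/
theorem oneStepVar_nonneg (b : ℕ) (φ : (Π n, X n) → ℝ) (h : Π i : Iic b, X i) : 0 ≤ oneStepVar κ b φ h :=
  integral_nonneg fun _ => sq_nonneg _

/-- [folklore] **Frozen form of the one-step variance**: an integral over the whole sub-tower below `h` (levels `≤ b`
frozen at `h` by `updateFinset`), convenient for pointwise estimates. -/
theorem oneStepVar_eq_integral_traj (b : ℕ) {φ : (Π n, X n) → ℝ} (hφm : StronglyMeasurable φ)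
    (h : Π i : Iic b, X i) :
    oneStepVar κ b φ h = ∫ y, (fiberMean κ (b + 1) φ (frestrictLe (b + 1) (updateFinset y (Iic b) h)) -
      fiberMean κ b φ h) ^ 2 ∂(Kernel.traj κ b h) := by
  have hψ1 : StronglyMeasurable (fiberMean κ (b + 1) φ) := stronglyMeasurable_fiberMean _ hφm
  have hG'm : StronglyMeasurable (fun y : Π n, X n =>
      (fiberMean κ (b + 1) φ (frestrictLe (b + 1) y) - fiberMean κ b φ h) ^ 2) :=
    ((hψ1.comp_measurable (measurable_frestrictLe _)).sub stronglyMeasurable_const).pow 2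
  rw [← Kernel.integral_traj h hG'm.aestronglyMeasurable, oneStepVar, ← Kernel.traj_map_frestrictLe_apply,
    integral_map (measurable_frestrictLe _).aemeasurable]
  exact ((hψ1.sub stronglyMeasurable_const).pow 2).aestronglyMeasurable

/-- [folklore] **SUP-OSCILLATION ⇒ ONE-STEP VARIANCE**: if every extension `u` of the history `h` by one level moves
the fibre mean by at most `σ`, then `oneStepVar κ b φ h ≤ σ²`.  (This is the form in which per-history
analyticity / localisation bounds on the conditional mean of the dressing observable enter.) -/
theorem oneStepVar_le_sq_of_osc (b : ℕ) {φ : (Π n, X n) → ℝ} (hφm : StronglyMeasurable φ)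
    (h : Π i : Iic b, X i) {σ : ℝ}
    (hσ : ∀ u : Π i : Iic (b + 1), X i, frestrictLe₂ (Nat.le_succ b) u = h →
      |fiberMean κ (b + 1) φ u - fiberMean κ b φ h| ≤ σ) :
    oneStepVar κ b φ h ≤ σ ^ 2 := by
  rw [oneStepVar_eq_integral_traj b hφm h]
  have hpt : ∀ y : Π n, X n, (fiberMean κ (b + 1) φ (frestrictLe (b + 1) (updateFinset y (Iic b) h)) -
      fiberMean κ b φ h) ^ 2 ≤ σ ^ 2 := by
    intro y
    have hu := hσ (frestrictLe (b + 1) (updateFinset y (Iic b) h)) (by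
      simpa [frestrictLe_updateFinset] using
        congrFun (frestrictLe₂_comp_frestrictLe (π := X) (Nat.le_succ b)) (updateFinset y (Iic b) h))
    exact sq_le_sq' (abs_le.mp hu).1 (abs_le.mp hu).2
  calc _ ≤ ∫ _, σ ^ 2 ∂(Kernel.traj κ b h) :=
        integral_mono_of_nonneg (ae_of_all _ fun y => sq_nonneg _) (integrable_const _) (ae_of_all _ hpt)
    _ = σ ^ 2 := by simp

/-- [folklore] The trivial budget: `oneStepVar κ b φ h ≤ (2R)²` for `|φ| ≤ R`. -/
theorem oneStepVar_le (b : ℕ) {φ : (Π n, X n) → ℝ} (hφm : StronglyMeasurable φ) {R : ℝ}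
    (hφR : ∀ x, |φ x| ≤ R) (h : Π i : Iic b, X i) : oneStepVar κ b φ h ≤ (2 * R) ^ 2 :=
  oneStepVar_le_sq_of_osc b hφm h fun u _ =>
    calc |fiberMean κ (b + 1) φ u - fiberMean κ b φ h|
        ≤ |fiberMean κ (b + 1) φ u| + |fiberMean κ b φ h| := abs_sub _ _
      _ ≤ R + R := add_le_add (abs_fiberMean_le _ hφm hφR _) (abs_fiberMean_le _ hφm hφR _)
      _ = 2 * R := by ring

/-- [folklore] -/
theorem abs_oneStepVar_le (b : ℕ) {φ : (Π n, X n) → ℝ} (hφm : StronglyMeasurable φ) {R : ℝ}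
    (hφR : ∀ x, |φ x| ≤ R) (h : Π i : Iic b, X i) : |oneStepVar κ b φ h| ≤ (2 * R) ^ 2 := by
  rw [abs_of_nonneg (oneStepVar_nonneg b φ h)]
  exact oneStepVar_le b hφm hφR h

/-- [folklore] The one-step variance is a measurable function of the history (so `W b := oneStepVar κ b φ` is an
admissible predictable proxy). -/
theorem stronglyMeasurable_oneStepVar (b : ℕ) {φ : (Π n, X n) → ℝ} (hφm : StronglyMeasurable φ) :
    StronglyMeasurable (oneStepVar κ b φ) := by
  have hψ1 : StronglyMeasurable (fiberMean κ (b + 1) φ) := stronglyMeasurable_fiberMean _ hφm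
  have hψ0 : StronglyMeasurable (fiberMean κ b φ) := stronglyMeasurable_fiberMean _ hφm
  have hF : StronglyMeasurable (uncurry fun (h : Π i : Iic b, X i) (u : Π i : Iic (b + 1), X i) =>
      (fiberMean κ (b + 1) φ u - fiberMean κ b φ h) ^ 2) :=
    ((hψ1.comp_measurable measurable_snd).sub (hψ0.comp_measurable measurable_fst)).pow 2
  exact hF.integral_kernel_prod_right (κ := Kernel.partialTraj κ b (b + 1))

/-- [folklore] **THE CONDITIONAL SECOND MOMENT OF A ONE-STEP DIFFERENCE IS THE ONE-STEP VARIANCE.**  For bounded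
measurable `φ`: `μ[(fiberMean κ (b+1) φ (x≤b+1) − fiberMean κ b φ (x≤b))² ∣ piLE b] = oneStepVar κ b φ (x≤b)` a.e. -/
theorem condExp_sq_sub_ae_eq (ν : Measure (X 0)) [IsFiniteMeasure ν] (b : ℕ) {φ : (Π n, X n) → ℝ}
    (hφm : StronglyMeasurable φ) {R : ℝ} (hφR : ∀ x, |φ x| ≤ R) :
    (Kernel.trajMeasure ν κ)[fun x =>
        (fiberMean κ (b + 1) φ (frestrictLe (b + 1) x) - fiberMean κ b φ (frestrictLe b x)) ^ 2 | piLE (X := X) b]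
      =ᵐ[Kernel.trajMeasure ν κ] fun x => oneStepVar κ b φ (frestrictLe b x) := by
  -- the integrand `G` is bounded and measurable
  set G : (Π n, X n) → ℝ := fun x =>
    (fiberMean κ (b + 1) φ (frestrictLe (b + 1) x) - fiberMean κ b φ (frestrictLe b x)) ^ 2 with hG
  have hψ1 : StronglyMeasurable (fiberMean κ (b + 1) φ) := stronglyMeasurable_fiberMean _ hφm
  have hψ0 : StronglyMeasurable (fiberMean κ b φ) := stronglyMeasurable_fiberMean _ hφm
  have hDm : StronglyMeasurable (fun x : Π n, X n =>
      fiberMean κ (b + 1) φ (frestrictLe (b + 1) x) - fiberMean κ b φ (frestrictLe b x)) :=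
    (hψ1.comp_measurable (measurable_frestrictLe _)).sub (hψ0.comp_measurable (measurable_frestrictLe _))
  have hDb : ∀ x : Π n, X n,
      |fiberMean κ (b + 1) φ (frestrictLe (b + 1) x) - fiberMean κ b φ (frestrictLe b x)| ≤ 2 * R := by
    intro x
    calc |fiberMean κ (b + 1) φ (frestrictLe (b + 1) x) - fiberMean κ b φ (frestrictLe b x)|
        ≤ |fiberMean κ (b + 1) φ (frestrictLe (b + 1) x)| + |fiberMean κ b φ (frestrictLe b x)| := abs_sub _ _
      _ ≤ R + R := add_le_add (abs_fiberMean_le _ hφm hφR _) (abs_fiberMean_le _ hφm hφR _)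
      _ = 2 * R := by ring
  have hGm : StronglyMeasurable G := hDm.pow 2
  have hGi : Integrable G (Kernel.trajMeasure ν κ) :=
    integrable_sq_of_ae_abs_le hDm.aestronglyMeasurable (ae_of_all _ hDb)
  -- conditional expectation = fibre mean of `G`; then compute the fibre mean of `G` on each fibre
  refine (condExp_piLE_ae_eq ν b hGi).trans (ae_of_all _ fun x => ?_)
  simp only [fiberMean_apply]
  generalize frestrictLe b x = h
  -- freeze the levels `≤ b` at `h` inside the fibre integral (`Kernel.integral_traj`) and compare with the
  -- frozen form of the one-step variance
  rw [Kernel.integral_traj h hGm.aestronglyMeasurable, oneStepVar_eq_integral_traj b hφm h]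
  refine integral_congr_ae (ae_of_all _ fun y => ?_)
  simp only [hG, frestrictLe_updateFinset]

end Chain

/-! ## §4  The Doob–Lévy increments of the frame and the discharge of the hypothesis shapes -/

section Increments

variable {κ : (b : ℕ) → Kernel (Π i : Iic b, X i) (X (b + 1))} [∀ b, IsMarkovKernel (κ b)]

/-- [folklore] **THE INCREMENTS ARE ONE-STEP FLUCTUATIONS OF THE FIBRE MEANS.**  For `i < n` and `b := n − (i+1)`:
`incr μ F φ i = fiberMean κ (b+1) φ (x≤b+1) − fiberMean κ b φ (x≤b)` `μ`-a.e. (`μ = trajMeasure ν κ`,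
`F = frameFiltration X n`). -/
theorem incr_frame_ae_eq (ν : Measure (X 0)) [IsFiniteMeasure ν] (n : ℕ) {φ : (Π k, X k) → ℝ}
    (hφ : Integrable φ (Kernel.trajMeasure ν κ)) {i : ℕ} (hi : i < n) :
    incr (Kernel.trajMeasure ν κ) (frameFiltration X n) φ i =ᵐ[Kernel.trajMeasure ν κ]
      fun x => fiberMean κ (n - (i + 1) + 1) φ (frestrictLe (n - (i + 1) + 1) x) -
        fiberMean κ (n - (i + 1)) φ (frestrictLe (n - (i + 1)) x) := by
  filter_upwards [condExp_piLE_ae_eq (κ := κ) ν (n - (i + 1) + 1) hφ,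
    condExp_piLE_ae_eq (κ := κ) ν (n - (i + 1)) hφ] with x h1 h2
  rw [incr_apply, frameFiltration_eq_succ hi, frameFiltration_apply, h1, h2]

/-- [folklore] **THE CONDITIONAL VARIANCE OF AN INCREMENT IS THE ONE-STEP VARIANCE**: for bounded measurable `φ`,
`i < n`, `b := n − (i+1)`: `μ[(incr μ F φ i)² ∣ F (i+1)] = oneStepVar κ b φ (x≤b)` a.e. -/
theorem condExp_incr_sq_frame_ae_eq (ν : Measure (X 0)) [IsFiniteMeasure ν] (n : ℕ) {φ : (Π k, X k) → ℝ}
    (hφm : StronglyMeasurable φ) {R : ℝ} (hφR : ∀ x, |φ x| ≤ R) {i : ℕ} (hi : i < n) :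
    (Kernel.trajMeasure ν κ)[fun x => incr (Kernel.trajMeasure ν κ) (frameFiltration X n) φ i x ^ 2
        | frameFiltration X n (i + 1)]
      =ᵐ[Kernel.trajMeasure ν κ] fun x => oneStepVar κ (n - (i + 1)) φ (frestrictLe (n - (i + 1)) x) := by
  have hφ : Integrable φ (Kernel.trajMeasure ν κ) := integrable_of_abs_le_const hφm hφR
  have hsq : (fun x => incr (Kernel.trajMeasure ν κ) (frameFiltration X n) φ i x ^ 2)
      =ᵐ[Kernel.trajMeasure ν κ] fun x =>
        (fiberMean κ (n - (i + 1) + 1) φ (frestrictLe (n - (i + 1) + 1) x) -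
          fiberMean κ (n - (i + 1)) φ (frestrictLe (n - (i + 1)) x)) ^ 2 := by
    filter_upwards [incr_frame_ae_eq ν n hφ hi] with x hx
    rw [hx]
  rw [frameFiltration_apply]
  exact (condExp_congr_ae hsq).trans (condExp_sq_sub_ae_eq ν (n - (i + 1)) hφm hφR)

/-- [folklore] **DISCHARGE OF `IncrementVarProxy` FROM ONE-STEP VARIANCES.**  If for every chain level `b < n` and
EVERY history `h` the one-step variance is dominated by a function of the history, `oneStepVar κ b φ h ≤ W b h`,
then the frame carries the predictable variance proxies `V i := W (n−(i+1)) ∘ frestrictLe (n−(i+1))`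
(`F (i+1)`-measurable by `stronglyMeasurable_frameProxy` when the `W b` are measurable). -/
theorem incrementVarProxy_of_oneStepVar (ν : Measure (X 0)) [IsFiniteMeasure ν] (n : ℕ)
    {φ : (Π k, X k) → ℝ} (hφm : StronglyMeasurable φ) {R : ℝ} (hφR : ∀ x, |φ x| ≤ R)
    {W : (b : ℕ) → (Π i : Iic b, X i) → ℝ} (hW : ∀ b < n, ∀ h, oneStepVar κ b φ h ≤ W b h) :
    IncrementVarProxy (Kernel.trajMeasure ν κ) (frameFiltration X n) φ n
      (fun i x => W (n - (i + 1)) (frestrictLe (n - (i + 1)) x)) := by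
  intro i hi
  filter_upwards [condExp_incr_sq_frame_ae_eq ν n hφm hφR hi] with x hx
  rw [hx]
  exact hW _ (by omega) _

/-- [folklore] **DISCHARGE OF `IncrementVarBound` FROM ONE-STEP VARIANCES** (constant budgets `v b`). -/
theorem incrementVarBound_of_oneStepVar (ν : Measure (X 0)) [IsFiniteMeasure ν] (n : ℕ)
    {φ : (Π k, X k) → ℝ} (hφm : StronglyMeasurable φ) {R : ℝ} (hφR : ∀ x, |φ x| ≤ R)
    {v : ℕ → ℝ} (hv : ∀ b < n, ∀ h, oneStepVar κ b φ h ≤ v b) :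
    IncrementVarBound (Kernel.trajMeasure ν κ) (frameFiltration X n) φ n (fun i => v (n - (i + 1))) := by
  intro i hi
  filter_upwards [condExp_incr_sq_frame_ae_eq ν n hφm hφR hi] with x hx
  rw [hx]
  exact hv _ (by omega) _

/-- [folklore] **DISCHARGE OF `IncrementBound` FROM THE SUP-OSCILLATION OF THE FIBRE MEANS**: if for every `b < n`
and every history `u` of length `b+1` the depth-`(b+1)` fibre mean differs from the depth-`b` fibre mean of its
truncation by at most `σ b`, then `|incr μ F φ i| ≤ σ (n−(i+1))` a.e. -/
theorem incrementBound_of_oneStepOsc (ν : Measure (X 0)) [IsFiniteMeasure ν] (n : ℕ)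
    {φ : (Π k, X k) → ℝ} (hφ : Integrable φ (Kernel.trajMeasure ν κ)) {σ : ℕ → ℝ}
    (hσ : ∀ b < n, ∀ u : Π i : Iic (b + 1), X i,
      |fiberMean κ (b + 1) φ u - fiberMean κ b φ (frestrictLe₂ (Nat.le_succ b) u)| ≤ σ b) :
    IncrementBound (Kernel.trajMeasure ν κ) (frameFiltration X n) φ n (fun i => σ (n - (i + 1))) := by
  intro i hi
  filter_upwards [incr_frame_ae_eq ν n hφ hi] with x hx
  rw [hx]
  have hre : frestrictLe (n - (i + 1)) x =
      frestrictLe₂ (π := X) (Nat.le_succ (n - (i + 1))) (frestrictLe (n - (i + 1) + 1) x) :=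
    (congrFun (frestrictLe₂_comp_frestrictLe (π := X) (Nat.le_succ (n - (i + 1)))) x).symm
  rw [hre]
  exact hσ _ (by omega) _

/-- [folklore] **DISCHARGE OF `IncrementVarProxy` FROM PER-HISTORY SUP-OSCILLATIONS**: if for every `b < n` and
every history `u` of length `b+1` the one-step move of the fibre mean is at most `s b (u≤b)` — a function of the
COARSER history only — then `(s (n−(i+1)) ∘ frestrictLe (n−(i+1)))²` are predictable variance proxies.  This is
the shape in which MI-F1-K (record `t4/T4-EST-NE1p-P2.md` v1.9) is consumed. -/
theorem incrementVarProxy_of_oneStepOsc (ν : Measure (X 0)) [IsFiniteMeasure ν] (n : ℕ)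
    {φ : (Π k, X k) → ℝ} (hφm : StronglyMeasurable φ) {R : ℝ} (hφR : ∀ x, |φ x| ≤ R)
    {s : (b : ℕ) → (Π i : Iic b, X i) → ℝ}
    (hs : ∀ b < n, ∀ u : Π i : Iic (b + 1), X i,
      |fiberMean κ (b + 1) φ u - fiberMean κ b φ (frestrictLe₂ (Nat.le_succ b) u)| ≤
        s b (frestrictLe₂ (Nat.le_succ b) u)) :
    IncrementVarProxy (Kernel.trajMeasure ν κ) (frameFiltration X n) φ n
      (fun i x => s (n - (i + 1)) (frestrictLe (n - (i + 1)) x) ^ 2) :=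
  incrementVarProxy_of_oneStepVar ν n hφm hφR (W := fun b h => s b h ^ 2) fun b hb h =>
    oneStepVar_le_sq_of_osc b hφm h fun u hu => by simpa only [hu] using hs b hb u

/-- [folklore] Boundedness of the frame proxies (binder `hVb`) from a uniform bound on the `W b`. -/
theorem ae_abs_frameProxy_le {μ : Measure (Π k, X k)} (n : ℕ) {W : (b : ℕ) → (Π i : Iic b, X i) → ℝ}
    {Vmax : ℝ} (hWb : ∀ b < n, ∀ h, |W b h| ≤ Vmax) (i : ℕ) (hi : i < n) :
    ∀ᵐ x ∂μ, |W (n - (i + 1)) (frestrictLe (n - (i + 1)) x)| ≤ Vmax :=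
  ae_of_all μ fun x => hWb _ (by omega) _

end Increments

/-! ## §5  The endpoint: marginal, coupling identity in kernel form, and the end-to-end bound -/

section Endpoint

variable {κ : (b : ℕ) → Kernel (Π i : Iic b, X i) (X (b + 1))} [∀ b, IsMarkovKernel (κ b)]

/-- [folklore] The length-`0` history with endpoint value `z` (Mathlib's `uniqueElim`, the inverse of the
measurable equivalence `MeasurableEquiv.piUnique` used in `Kernel.trajMeasure`). -/
def endpointHistory (z : X 0) : Π i : Iic 0, X i :=
  uniqueElim (α := fun i : Iic 0 => X i) z

omit [∀ n, MeasurableSpace (X n)] in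
/-- [folklore] -/
theorem endpointHistory_apply_default (z : X 0) : endpointHistory z default = z := rfl

/-- [folklore] -/
theorem measurable_endpointHistory : Measurable (endpointHistory (X := X)) :=
  measurable_uniqueElim

/-- [folklore] **The level-`0` marginal of the path law is the endpoint law** (transported to length-`0` histories):
`(trajMeasure ν κ).map (frestrictLe 0) = ν.map endpointHistory`. -/
theorem map_frestrictLe_zero_trajMeasure (ν : Measure (X 0)) :
    (Kernel.trajMeasure ν κ).map (frestrictLe 0) = ν.map endpointHistory := by
  rw [Kernel.trajMeasure, Measure.map_comp _ _ (measurable_frestrictLe 0), Kernel.traj_map_frestrictLe,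
    Kernel.partialTraj_self, Measure.id_comp]
  rfl

/-- [folklore] **Functions of the endpoint integrate against `ν`**: `∫ G(x≤0) dμ = ∫ G(endpointHistory z) dν(z)`. -/
theorem integral_endpoint_eq (ν : Measure (X 0)) [IsFiniteMeasure ν] {G : (Π i : Iic 0, X i) → ℝ}
    (hG : StronglyMeasurable G) :
    ∫ x, G (frestrictLe 0 x) ∂(Kernel.trajMeasure ν κ) = ∫ z, G (endpointHistory z) ∂ν := by
  rw [← integral_map (measurable_frestrictLe 0).aemeasurable hG.aestronglyMeasurable,
    map_frestrictLe_zero_trajMeasure,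
    integral_map measurable_endpointHistory.aemeasurable hG.aestronglyMeasurable]

/-- [folklore] The ENDPOINT VALUE of a length-`0` history (the coordinate at the unique index `default = ⟨0, _⟩`,
read at type `X 0`). -/
def endpointValue (h : Π i : Iic 0, X i) : X 0 := h default

/-- [folklore] -/
theorem measurable_endpointValue : Measurable (endpointValue (X := X)) := measurable_pi_apply _

omit [∀ n, MeasurableSpace (X n)] in
/-- [folklore] -/
theorem endpointValue_endpointHistory (z : X 0) : endpointValue (endpointHistory z) = z := rfl

omit [∀ n, MeasurableSpace (X n)] in
/-- [folklore] The coordinate `x 0` is the endpoint value of the length-`0` history `frestrictLe 0 x`. -/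
theorem endpointValue_frestrictLe_zero (x : Π k, X k) : endpointValue (frestrictLe 0 x) = x 0 := rfl

omit [∀ n, MeasurableSpace (X n)] in
/-- [folklore] The length-`0` history of a path is the endpoint history of its endpoint value. -/
theorem frestrictLe_zero_eq_endpointHistory (x : Π k, X k) : frestrictLe 0 x = endpointHistory (x 0) := by
  funext i
  rw [Unique.eq_default i]
  rfl

/-- [folklore] The TOWER MEAN of a path observable below the endpoint value `z`: `∫ φ d(traj κ 0 (endpointHistory z))`
(`= μ[φ ∣ endpoint]` at `x 0 = z`, by `condExp_piLE_ae_eq` with `b = 0`). -/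
def towerMean (κ : (b : ℕ) → Kernel (Π i : Iic b, X i) (X (b + 1))) [∀ b, IsMarkovKernel (κ b)]
    (φ : (Π n, X n) → ℝ) (z : X 0) : ℝ :=
  fiberMean κ 0 φ (endpointHistory z)

/-- [folklore] The TOWER MOMENT-GENERATING FUNCTION (the DRESSING FACTOR of the endpoint value `z`):
`towerMGF κ φ t z = ∫ e^{t φ} d(traj κ 0 (endpointHistory z))`. -/
def towerMGF (κ : (b : ℕ) → Kernel (Π i : Iic b, X i) (X (b + 1))) [∀ b, IsMarkovKernel (κ b)]
    (φ : (Π n, X n) → ℝ) (t : ℝ) (z : X 0) : ℝ :=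
  fiberMean κ 0 (fun y => Real.exp (t * φ y)) (endpointHistory z)

/-- [folklore] **The conditional mean of a path observable given the endpoint is the tower mean of the endpoint
value**: `μ[φ ∣ piLE 0] = towerMean κ φ (x 0)` a.e. -/
theorem condExp_endpoint_ae_eq_towerMean (ν : Measure (X 0)) [IsFiniteMeasure ν] {φ : (Π n, X n) → ℝ}
    (hφ : Integrable φ (Kernel.trajMeasure ν κ)) :
    (Kernel.trajMeasure ν κ)[φ | piLE (X := X) 0] =ᵐ[Kernel.trajMeasure ν κ] fun x => towerMean κ φ (x 0) := by
  filter_upwards [condExp_piLE_ae_eq ν 0 hφ] with x hx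
  rw [hx, towerMean, frestrictLe_zero_eq_endpointHistory]

/-- [folklore] -/
theorem stronglyMeasurable_towerMean {φ : (Π n, X n) → ℝ} (hφm : StronglyMeasurable φ) :
    StronglyMeasurable (towerMean κ φ) :=
  (stronglyMeasurable_fiberMean 0 hφm).comp_measurable measurable_endpointHistory

/-- [folklore] -/
theorem exp_mul_bounds {φ : (Π n, X n) → ℝ} (hφm : StronglyMeasurable φ) {R : ℝ} (hφR : ∀ x, |φ x| ≤ R) (t : ℝ) :
    StronglyMeasurable (fun y => Real.exp (t * φ y)) ∧ ∀ y, |Real.exp (t * φ y)| ≤ Real.exp (|t| * R) := by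
  refine ⟨Real.continuous_exp.comp_stronglyMeasurable (hφm.const_mul t), fun y => ?_⟩
  rw [abs_of_pos (Real.exp_pos _)]
  refine Real.exp_le_exp.mpr ?_
  calc t * φ y ≤ |t * φ y| := le_abs_self _
    _ = |t| * |φ y| := abs_mul _ _
    _ ≤ |t| * R := mul_le_mul_of_nonneg_left (hφR y) (abs_nonneg _)

/-- [folklore] -/
theorem stronglyMeasurable_towerMGF {φ : (Π n, X n) → ℝ} (hφm : StronglyMeasurable φ) (t : ℝ) :
    StronglyMeasurable (towerMGF κ φ t) :=
  (stronglyMeasurable_fiberMean 0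
    (Real.continuous_exp.comp_stronglyMeasurable (hφm.const_mul t))).comp_measurable
      measurable_endpointHistory

/-- [folklore] **THE COUPLING IDENTITY IN KERNEL FORM — dressed endpoint law = `ν` reweighted by the tower MGF.**
For a bounded measurable path observable `φ`, a bounded measurable endpoint observable `g₀` and every `t`:
`∫ g₀(x 0)·e^{t φ(x)} d(trajMeasure ν κ)(x) = ∫ g₀(z)·towerMGF κ φ t z dν(z)`.
(`T4PathwiseCoupling.integral_mul_exp_eq_integral_mul_dressingFactor` with the endpoint σ-algebra `piLE 0`, the explicit
conditional expectation `condExp_piLE_ae_eq`, and the marginal `integral_endpoint_eq`.) -/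
theorem integral_mul_exp_eq_integral_towerMGF (ν : Measure (X 0)) [IsFiniteMeasure ν]
    {φ : (Π n, X n) → ℝ} (hφm : StronglyMeasurable φ) {R : ℝ} (hφR : ∀ x, |φ x| ≤ R)
    {g₀ : X 0 → ℝ} (hg : StronglyMeasurable g₀) {Cg : ℝ} (hgC : ∀ z, |g₀ z| ≤ Cg) (t : ℝ) :
    ∫ x, g₀ (x 0) * Real.exp (t * φ x) ∂(Kernel.trajMeasure ν κ) =
      ∫ z, g₀ z * towerMGF κ φ t z ∂ν := by
  obtain ⟨hem, heb⟩ := exp_mul_bounds hφm hφR t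
  have hgm : StronglyMeasurable[piLE (X := X) 0] (fun x : Π k, X k => g₀ (x 0)) :=
    hg.comp_measurable (measurable_eval_piLE (le_refl 0))
  -- step 1: dressed = undressed × conditional dressing factor given the endpoint
  rw [integral_mul_exp_eq_integral_mul_dressingFactor (μ := Kernel.trajMeasure ν κ) hφm.aestronglyMeasurable
    hφR (fun x => hgC (x 0)) ((piLE (X := X)).le 0) hgm t]
  -- step 2: the conditional dressing factor is the tower MGF of the endpoint
  have hce := condExp_piLE_ae_eq (κ := κ) ν 0
    (integrable_of_abs_le_const (μ := Kernel.trajMeasure ν κ) hem heb)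
  have h2 : ∫ x, g₀ (x 0) * (Kernel.trajMeasure ν κ)[fun x => Real.exp (t * φ x) | piLE (X := X) 0] x
        ∂(Kernel.trajMeasure ν κ) =
      ∫ x, g₀ (endpointValue (frestrictLe 0 x)) *
        fiberMean κ 0 (fun y => Real.exp (t * φ y)) (frestrictLe 0 x) ∂(Kernel.trajMeasure ν κ) := by
    refine integral_congr_ae ?_
    filter_upwards [hce] with x hx
    rw [hx]
    rfl
  have hGm : StronglyMeasurable
      (fun h : Π i : Iic 0, X i => g₀ (endpointValue h) * fiberMean κ 0 (fun y => Real.exp (t * φ y)) h) :=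
    (Measurable.mul (f := fun h : Π i : Iic 0, X i => g₀ (endpointValue h))
      (g := fiberMean κ 0 (fun y => Real.exp (t * φ y))) (hg.measurable.comp measurable_endpointValue)
      (stronglyMeasurable_fiberMean (κ := κ) 0 hem).measurable).stronglyMeasurable
  rw [h2, integral_endpoint_eq (κ := κ) ν hGm]
  refine integral_congr_ae (ae_of_all ν fun z => ?_)
  simp only [towerMGF, endpointValue_endpointHistory]

/-- [folklore] The undressed side: `∫ g₀(x 0)·e^{t·μ[φ ∣ F n]} dμ = ∫ g₀(z)·e^{t·towerMean κ φ z} dν(z)`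
(`F n = piLE 0`; the conditional mean of `φ` given the endpoint is the tower mean). -/
theorem integral_mul_exp_condExp_endpoint_eq (ν : Measure (X 0)) [IsFiniteMeasure ν] (n : ℕ)
    {φ : (Π k, X k) → ℝ} (hφm : StronglyMeasurable φ) {R : ℝ} (hφR : ∀ x, |φ x| ≤ R)
    {g₀ : X 0 → ℝ} (hg : StronglyMeasurable g₀) (t : ℝ) :
    ∫ x, g₀ (x 0) * Real.exp (t * (Kernel.trajMeasure ν κ)[φ | frameFiltration X n n] x)
        ∂(Kernel.trajMeasure ν κ) =
      ∫ z, g₀ z * Real.exp (t * towerMean κ φ z) ∂ν := by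
  rw [frameFiltration_self]
  have hce := condExp_piLE_ae_eq (κ := κ) ν 0
    (integrable_of_abs_le_const (μ := Kernel.trajMeasure ν κ) hφm hφR)
  have h2 : ∫ x, g₀ (x 0) * Real.exp (t * (Kernel.trajMeasure ν κ)[φ | piLE (X := X) 0] x)
        ∂(Kernel.trajMeasure ν κ) =
      ∫ x, g₀ (endpointValue (frestrictLe 0 x)) * Real.exp (t * fiberMean κ 0 φ (frestrictLe 0 x))
        ∂(Kernel.trajMeasure ν κ) := by
    refine integral_congr_ae ?_
    filter_upwards [hce] with x hx
    rw [hx]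
    rfl
  have hGm : StronglyMeasurable
      (fun h : Π i : Iic 0, X i => g₀ (endpointValue h) * Real.exp (t * fiberMean κ 0 φ h)) :=
    (Measurable.mul (f := fun h : Π i : Iic 0, X i => g₀ (endpointValue h))
      (g := fun h => Real.exp (t * fiberMean κ 0 φ h)) (hg.measurable.comp measurable_endpointValue)
      (Real.measurable_exp.comp
        ((stronglyMeasurable_fiberMean (κ := κ) 0 hφm).measurable.const_mul t))).stronglyMeasurable
  rw [h2, integral_endpoint_eq (κ := κ) ν hGm]
  refine integral_congr_ae (ae_of_all ν fun z => ?_)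
  simp only [towerMean, endpointValue_endpointHistory]

omit [∀ n, MeasurableSpace (X n)] in
/-- [folklore] Re-indexing the frame proxies by chain level: `Σ_{i<n} W (n−(i+1)) (x≤n−(i+1)) = Σ_{b<n} W b (x≤b)`. -/
theorem sum_frameProxy_eq (n : ℕ) (W : (b : ℕ) → (Π i : Iic b, X i) → ℝ) (x : Π k, X k) :
    ∑ i ∈ range n, W (n - (i + 1)) (frestrictLe (n - (i + 1)) x) =
      ∑ b ∈ range n, W b (frestrictLe b x) := by
  have h := Finset.sum_range_reflect (fun b => W b (frestrictLe b x)) n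
  rw [← h]
  refine Finset.sum_congr rfl fun i hi => ?_
  have : n - 1 - i = n - (i + 1) := by omega
  rw [this]

/-- [folklore] **END-TO-END: THE INTEGRATED RANDOM-GEOMETRY BOUND OF NE1′ IN KERNEL FORM.**
Tower of depth `n` with fibre kernels `κ` and finite endpoint law `ν`; a bounded (`|φ| ≤ R`) path observable `φ`
depending on the levels `≤ n` (`piLE n`-measurable); per-history one-step variance dominators `W b` (measurable,
`|W b| ≤ Vmax`, `oneStepVar κ b φ ≤ W b` for `b < n`); `|t|·2R ≤ 1`; a bounded non-negative endpoint observable `g₀`.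
Then for every budget `B`:
`∫ g₀(x 0) e^{tφ} dμ ≤ e^{t²B}·∫ g₀(z) e^{t·towerMean κ φ z} dν(z) + e^{|t|R}·Cg·μ{x ∣ B < Σ_{b<n} W b (x≤b)}`.
This is `T4PathwiseCoupling.integral_mul_exp_le_of_varProxy` with EVERY frame binder discharged by this module
(`antitone_frameFiltration`, `frameFiltration_le`, `stronglyMeasurable_frameProxy`, `incrementVarProxy_of_oneStepVar`)
and both endpoint integrals pushed down to `ν`; the other consumers of that module
(`integral_mul_exp_le_uniform_of_nesting(_add)`, `…_of_predictableDomainSplit…`) take the same discharged binders. -/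
theorem integral_mul_exp_le_of_oneStepVar (ν : Measure (X 0)) [IsFiniteMeasure ν] (n : ℕ)
    {φ : (Π k, X k) → ℝ} (hφn : StronglyMeasurable[piLE (X := X) n] φ) {R : ℝ} (hφR : ∀ x, |φ x| ≤ R)
    {W : (b : ℕ) → (Π i : Iic b, X i) → ℝ} (hWm : ∀ b, StronglyMeasurable (W b)) {Vmax : ℝ}
    (hWb : ∀ b < n, ∀ h, |W b h| ≤ Vmax) (hW : ∀ b < n, ∀ h, oneStepVar κ b φ h ≤ W b h)
    {t : ℝ} (ht : |t| * (2 * R) ≤ 1) (B : ℝ) {g₀ : X 0 → ℝ} (hg : StronglyMeasurable g₀)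
    (hg0 : ∀ z, 0 ≤ g₀ z) {Cg : ℝ} (hgC : ∀ z, g₀ z ≤ Cg) :
    ∫ x, g₀ (x 0) * Real.exp (t * φ x) ∂(Kernel.trajMeasure ν κ) ≤
      Real.exp (t ^ 2 * B) * ∫ z, g₀ z * Real.exp (t * towerMean κ φ z) ∂ν +
        Real.exp (|t| * R) * (Cg * (Kernel.trajMeasure ν κ).real
          {x | B < ∑ b ∈ range n, W b (frestrictLe b x)}) := by
  have hφm : StronglyMeasurable φ := hφn.mono ((piLE (X := X)).le n)
  have hmain := integral_mul_exp_le_of_varProxy (μ := Kernel.trajMeasure ν κ) (antitone_frameFiltration n)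
    (frameFiltration_le n)
    (stronglyMeasurable_frame_zero hφn) hφR n
    (V := fun i x => W (n - (i + 1)) (frestrictLe (n - (i + 1)) x)) (Vmax := Vmax)
    (fun i _ => stronglyMeasurable_frameProxy hWm n i) (fun i hi => ae_abs_frameProxy_le n hWb i hi)
    (incrementVarProxy_of_oneStepVar ν n hφm hφR hW) ht B (stronglyMeasurable_endpoint hg n n)
    (fun x => hg0 (x 0)) (fun x => hgC (x 0))
  rw [integral_mul_exp_condExp_endpoint_eq ν n hφm hφR hg t] at hmain
  have hset : {x : Π k, X k | B < ∑ i ∈ range n, W (n - (i + 1)) (frestrictLe (n - (i + 1)) x)} =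
      {x | B < ∑ b ∈ range n, W b (frestrictLe b x)} := by
    ext x
    simp only [Set.mem_setOf_eq, sum_frameProxy_eq]
  rw [hset] at hmain
  exact hmain

/-- [folklore] **END-TO-END WITH THE EXACT CONDITIONAL VARIANCES AS PROXIES.**  Same as
`integral_mul_exp_le_of_oneStepVar` with `W b := oneStepVar κ b φ` itself (measurable, bounded by `(2R)²`):
`∫ g₀(x 0) e^{tφ} dμ ≤ e^{t²B}·∫ g₀(z) e^{t·towerMean κ φ z} dν(z) + e^{|t|R}·Cg·μ{x ∣ B < Σ_{b<n} oneStepVar κ b φ (x≤b)}`.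
The programme's missing inequality MI-F1 is thereby ISOLATED as a statement about the accumulated one-step variances
`Σ_{b<n} oneStepVar κ b φ (x≤b)` of the explicit fibre kernels: a budget `B` (μ-uniform) off an event of small
`μ`-mass (the (B)-currency large-field event). -/
theorem integral_mul_exp_le_condVar (ν : Measure (X 0)) [IsFiniteMeasure ν] (n : ℕ)
    {φ : (Π k, X k) → ℝ} (hφn : StronglyMeasurable[piLE (X := X) n] φ) {R : ℝ} (hφR : ∀ x, |φ x| ≤ R)
    {t : ℝ} (ht : |t| * (2 * R) ≤ 1) (B : ℝ) {g₀ : X 0 → ℝ} (hg : StronglyMeasurable g₀)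
    (hg0 : ∀ z, 0 ≤ g₀ z) {Cg : ℝ} (hgC : ∀ z, g₀ z ≤ Cg) :
    ∫ x, g₀ (x 0) * Real.exp (t * φ x) ∂(Kernel.trajMeasure ν κ) ≤
      Real.exp (t ^ 2 * B) * ∫ z, g₀ z * Real.exp (t * towerMean κ φ z) ∂ν +
        Real.exp (|t| * R) * (Cg * (Kernel.trajMeasure ν κ).real
          {x | B < ∑ b ∈ range n, oneStepVar κ b φ (frestrictLe b x)}) := by
  have hφm : StronglyMeasurable φ := hφn.mono ((piLE (X := X)).le n)
  exact integral_mul_exp_le_of_oneStepVar ν n hφn hφR (W := fun b => oneStepVar κ b φ)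
    (fun b => stronglyMeasurable_oneStepVar b hφm) (Vmax := (2 * R) ^ 2)
    (fun b _ h => abs_oneStepVar_le b hφm hφR h) (fun b _ h => le_rfl) ht B hg hg0 hgC

end Endpoint

/-! ## §6  The Markov-kernel realisation property -/

section Realisation

variable {κ : (b : ℕ) → Kernel (Π i : Iic b, X i) (X (b + 1))} [∀ b, IsMarkovKernel (κ b)]

/-- [folklore] **THE CONDITIONAL LAW OF LEVEL `b+1` GIVEN THE LEVELS `≤ b` IS THE FIBRE KERNEL `κ b`** (finite
endpoint law; Mathlib's `map_frestrictLe_trajMeasure_compProd_eq_map_trajMeasure` is the probability case):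
`μ.map (x≤b) ⊗ₘ κ b = μ.map (x ↦ (x≤b, x (b+1)))`.  This is the defining property of the realisation: on the coupled
path space each finer level is drawn from the printed one-step backward law given everything coarser. -/
theorem map_frestrictLe_succ_eq_compProd (ν : Measure (X 0)) [IsFiniteMeasure ν] (b : ℕ) :
    (Kernel.trajMeasure ν κ).map (frestrictLe b) ⊗ₘ κ b =
      (Kernel.trajMeasure ν κ).map (fun x => (frestrictLe b x, x (b + 1))) := by
  rw [Measure.compProd_eq_comp_prod, Kernel.trajMeasure, Measure.map_comp _ _ (measurable_frestrictLe b),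
    Kernel.traj_map_frestrictLe, Measure.comp_assoc, Measure.map_comp _ _ (by fun_prop)]
  congr 1
  ext h : 1
  rw [Kernel.comp_apply, ← Measure.compProd_eq_comp_prod, Kernel.map_apply _ (by fun_prop),
    Kernel.partialTraj_compProd_eq_map_traj (Nat.zero_le b)]

/-- [folklore] **THE LAW OF THE HISTORY OF LENGTH `b+1` IS THE ONE-STEP EXTENSION OF THE LAW OF THE HISTORY OF LENGTH
`b`**: `μ.map (x≤b+1) = partialTraj κ b (b+1) ∘ₘ μ.map (x≤b)`. -/
theorem map_frestrictLe_succ_eq_partialTraj_comp (ν : Measure (X 0)) (b : ℕ) :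
    (Kernel.trajMeasure ν κ).map (frestrictLe (b + 1)) =
      (Kernel.partialTraj κ b (b + 1)) ∘ₘ (Kernel.trajMeasure ν κ).map (frestrictLe b) := by
  rw [Kernel.trajMeasure, Measure.map_comp _ _ (measurable_frestrictLe b),
    Measure.map_comp _ _ (measurable_frestrictLe (b + 1)), Kernel.traj_map_frestrictLe,
    Kernel.traj_map_frestrictLe, Measure.comp_assoc,
    Kernel.partialTraj_comp_partialTraj (Nat.zero_le b) (Nat.le_succ b)]

end Realisation

/-! ## §7  The posterior-kernel presentation: EVERY finite path law is a realised tower -/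

section Posterior

/-- [folklore] The ONE-STEP GLUING of a length-`b` history and a level-`b+1` value into a length-`b+1` history
(Mathlib's `IicProdIoc b (b+1)` after `MeasurableEquiv.piSingleton b`). -/
def succGlue (b : ℕ) (p : (Π i : Iic b, X i) × X (b + 1)) : Π i : Iic (b + 1), X i :=
  IicProdIoc b (b + 1) (p.1, MeasurableEquiv.piSingleton b p.2)

/-- [folklore] -/
theorem measurable_succGlue (b : ℕ) : Measurable (succGlue (X := X) b) :=
  measurable_IicProdIoc.comp
    (measurable_fst.prodMk ((MeasurableEquiv.piSingleton b).measurable.comp measurable_snd))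

/-- [folklore] Gluing the length-`b` history of a path with its level-`b+1` value gives its length-`b+1` history. -/
theorem succGlue_pair (b : ℕ) (x : Π n, X n) :
    succGlue b (frestrictLe b x, x (b + 1)) = frestrictLe (b + 1) x := by
  funext i
  obtain ⟨j, hj⟩ := i
  by_cases h : j ≤ b
  · simp [succGlue, IicProdIoc, h]
  · have hj' : j = b + 1 := le_antisymm (mem_Iic.1 hj) (Nat.succ_le_of_lt (not_le.1 h))
    subst hj'
    have hs : (MeasurableEquiv.piSingleton b (x (b + 1))) ⟨b + 1, right_mem_Ioc.2 b.lt_succ_self⟩ =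
        x (b + 1) :=
      (MeasurableEquiv.piSingleton (X := X) b).symm_apply_apply (x (b + 1))
    simpa [succGlue, IicProdIoc, h] using hs

/-- [folklore] The law of the length-`b+1` history is the push-forward of the joint law of (length-`b` history,
level-`b+1` value) under the gluing. -/
theorem map_frestrictLe_succ_eq_map_pair_map (μ : Measure (Π n, X n)) (b : ℕ) :
    μ.map (frestrictLe (b + 1)) =
      (μ.map (fun x => (frestrictLe b x, x (b + 1)))).map (succGlue b) := by
  rw [Measure.map_map (measurable_succGlue b) ((measurable_frestrictLe b).prodMk (measurable_pi_apply _))]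
  congr 1
  funext x
  exact (succGlue_pair b x).symm

variable [∀ n, StandardBorelSpace (X n)] [∀ n, Nonempty (X n)]

/-- [folklore] The POSTERIOR ONE-STEP KERNELS of a finite path law `μ` on `Π n, X n` (standard Borel, non-empty
carriers): `posteriorKernel μ b` is the regular conditional law of the level `b+1` given the history `x≤b`
(Mathlib's `condDistrib`; it exists by the disintegration theorem and is unique `μ.map (x≤b)`-a.e.).  For the
printed chain presented backward these ARE the one-step backward laws of the record's dictionary — obtained from
the forward steps by Bayes' rule, with NOTHING of their printed form asserted. -/
def posteriorKernel (μ : Measure (Π n, X n)) [IsFiniteMeasure μ] (b : ℕ) :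
    Kernel (Π i : Iic b, X i) (X (b + 1)) :=
  condDistrib (fun x => x (b + 1)) (frestrictLe b) μ

/-- [folklore] The posterior one-step kernels are Markov kernels (Mathlib's `condDistrib` is). -/
instance instIsMarkovKernelPosteriorKernel (μ : Measure (Π n, X n)) [IsFiniteMeasure μ] (b : ℕ) :
    IsMarkovKernel (posteriorKernel μ b) := by
  unfold posteriorKernel
  infer_instance

/-- [folklore] **ONE-STEP DISINTEGRATION OF AN ARBITRARY PATH LAW**: `μ.map (x≤b) ⊗ₘ posteriorKernel μ b =
μ.map (x ↦ (x≤b, x (b+1)))`. -/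
theorem map_frestrictLe_compProd_posteriorKernel (μ : Measure (Π n, X n)) [IsFiniteMeasure μ] (b : ℕ) :
    μ.map (frestrictLe b) ⊗ₘ posteriorKernel μ b = μ.map (fun x => (frestrictLe b x, x (b + 1))) := by
  rw [posteriorKernel]
  exact compProd_map_condDistrib (measurable_pi_apply _).aemeasurable

/-- [folklore] **THE HISTORY LAWS OF `μ` ARE THOSE OF THE TOWER REALISED FROM ITS ENDPOINT LAW AND ITS POSTERIOR
KERNELS**: `(trajMeasure (μ.map (· 0)) (posteriorKernel μ)).map (x≤n) = μ.map (x≤n)` for every `n`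
(induction on `n`: both sides obey the same one-step recursion `law(x≤b+1) = (law(x≤b) ⊗ κ b).map succGlue`,
by `map_frestrictLe_succ_eq_compProd` on the tower side and by the disintegration on the `μ` side). -/
theorem map_frestrictLe_trajMeasure_posteriorKernel (μ : Measure (Π n, X n)) [IsFiniteMeasure μ] (n : ℕ) :
    (Kernel.trajMeasure (μ.map (fun x => x 0)) (posteriorKernel μ)).map (frestrictLe n) =
      μ.map (frestrictLe n) := by
  induction n with
  | zero =>
    rw [map_frestrictLe_zero_trajMeasure, Measure.map_map measurable_endpointHistory (measurable_pi_apply 0)]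
    congr 1
    funext x
    exact (frestrictLe_zero_eq_endpointHistory x).symm
  | succ b ih =>
    rw [map_frestrictLe_succ_eq_map_pair_map, map_frestrictLe_succ_eq_map_pair_map μ,
      ← map_frestrictLe_succ_eq_compProd, ih, map_frestrictLe_compProd_posteriorKernel]

/-- [folklore] **EVERY FINITE PATH LAW IS A REALISED TOWER**: a finite measure `μ` on `Π n, X n` (standard Borel,
non-empty carriers) IS the Ionescu–Tulcea measure of its endpoint law `μ.map (· 0)` and its posterior one-step
kernels: `trajMeasure (μ.map (· 0)) (posteriorKernel μ) = μ` (equality of the history laws for every length, then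
uniqueness of projective limits of finite measures).  Consequently EVERY theorem of §§3–6 applies to an ARBITRARY
finite path law with `κ := posteriorKernel μ`, `ν := μ.map (· 0)` — in particular to the undressed law of the
printed chain on its labelled level carriers (finite products of a compact metrisable group and finite label sets
are standard Borel), with no construction left to do. -/
theorem trajMeasure_posteriorKernel_eq (μ : Measure (Π n, X n)) [IsFiniteMeasure μ] :
    Kernel.trajMeasure (μ.map (fun x => x 0)) (posteriorKernel μ) = μ := by
  have hP : IsProjectiveMeasureFamily (fun I : Finset ℕ => μ.map I.restrict) := by
    intro I J hJI
    rw [Measure.map_map (Finset.measurable_restrict₂ hJI) (Finset.measurable_restrict I),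
      Finset.restrict₂_comp_restrict hJI]
  have h1 : IsProjectiveLimit μ (fun I : Finset ℕ => μ.map I.restrict) := fun I => rfl
  have h2 : IsProjectiveLimit (Kernel.trajMeasure (μ.map (fun x => x 0)) (posteriorKernel μ))
      (fun I : Finset ℕ => μ.map I.restrict) := by
    rw [isProjectiveLimit_nat_iff hP]
    intro n
    exact map_frestrictLe_trajMeasure_posteriorKernel μ n
  exact h2.unique h1

/-- [folklore] **CONDITIONAL EXPECTATIONS OF AN ARBITRARY PATH LAW GIVEN THE COARSE LEVELS ARE FIBRE INTEGRALS OF ITS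
POSTERIOR TOWER**: `μ[φ ∣ piLE b] = fiberMean (posteriorKernel μ) b φ (x≤b)` `μ`-a.e., for every integrable `φ`. -/
theorem condExp_piLE_ae_eq_fiberMean_posteriorKernel (μ : Measure (Π n, X n)) [IsFiniteMeasure μ] (b : ℕ)
    {φ : (Π n, X n) → ℝ} (hφ : Integrable φ μ) :
    μ[φ | piLE (X := X) b] =ᵐ[μ] fun x => fiberMean (posteriorKernel μ) b φ (frestrictLe b x) := by
  have h := @condExp_piLE_ae_eq X _ (posteriorKernel μ) inferInstance (μ.map (fun x => x 0)) inferInstance b φ ?_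
  · rw [trajMeasure_posteriorKernel_eq μ] at h
    exact h
  · rw [trajMeasure_posteriorKernel_eq μ]
    exact hφ

/-- [folklore] **THE CONDITIONAL MEAN OF AN ARBITRARY PATH LAW GIVEN THE ENDPOINT IS THE POSTERIOR TOWER MEAN**:
`μ[φ ∣ piLE 0] = towerMean (posteriorKernel μ) φ (x 0)` `μ`-a.e. -/
theorem condExp_endpoint_ae_eq_towerMean_posteriorKernel (μ : Measure (Π n, X n)) [IsFiniteMeasure μ]
    {φ : (Π n, X n) → ℝ} (hφ : Integrable φ μ) :
    μ[φ | piLE (X := X) 0] =ᵐ[μ] fun x => towerMean (posteriorKernel μ) φ (x 0) := by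
  have h := @condExp_endpoint_ae_eq_towerMean X _ (posteriorKernel μ) inferInstance (μ.map (fun x => x 0))
    inferInstance φ ?_
  · rw [trajMeasure_posteriorKernel_eq μ] at h
    exact h
  · rw [trajMeasure_posteriorKernel_eq μ]
    exact hφ

/-- [folklore] **THE DOOB INCREMENTS OF AN ARBITRARY PATH LAW ALONG THE FRAME ARE THE ONE-STEP FLUCTUATIONS OF THE
POSTERIOR FIBRE MEANS**: for integrable `φ` and `i < n`, with `b := n − (i+1)`,
`incr μ (frameFiltration X n) φ i = fiberMean (posteriorKernel μ) (b+1) φ (x≤b+1) − fiberMean (posteriorKernel μ) b φ (x≤b)`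
`μ`-a.e. -/
theorem incr_frame_ae_eq_posteriorKernel (μ : Measure (Π n, X n)) [IsFiniteMeasure μ] (n : ℕ)
    {φ : (Π k, X k) → ℝ} (hφ : Integrable φ μ) {i : ℕ} (hi : i < n) :
    incr μ (frameFiltration X n) φ i =ᵐ[μ]
      fun x => fiberMean (posteriorKernel μ) (n - (i + 1) + 1) φ (frestrictLe (n - (i + 1) + 1) x) -
        fiberMean (posteriorKernel μ) (n - (i + 1)) φ (frestrictLe (n - (i + 1)) x) := by
  have h := @incr_frame_ae_eq X _ (posteriorKernel μ) inferInstance (μ.map (fun x => x 0)) inferInstance n φ ?_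
    i hi
  · rw [trajMeasure_posteriorKernel_eq μ] at h
    exact h
  · rw [trajMeasure_posteriorKernel_eq μ]
    exact hφ

/-- [folklore] **THE CONDITIONAL VARIANCES OF THE INCREMENTS OF AN ARBITRARY PATH LAW ARE THE POSTERIOR ONE-STEP
VARIANCES** (`condExp_incr_sq_frame_ae_eq` transported along `trajMeasure_posteriorKernel_eq`): for bounded
measurable `φ`, `i < n`, `b := n − (i+1)`: `μ[(incr μ F φ i)² ∣ F (i+1)] = oneStepVar (posteriorKernel μ) b φ (x≤b)`
`μ`-a.e. -/
theorem condExp_incr_sq_frame_ae_eq_posteriorKernel (μ : Measure (Π n, X n)) [IsFiniteMeasure μ] (n : ℕ)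
    {φ : (Π k, X k) → ℝ} (hφm : StronglyMeasurable φ) {R : ℝ} (hφR : ∀ x, |φ x| ≤ R) {i : ℕ} (hi : i < n) :
    μ[fun x => incr μ (frameFiltration X n) φ i x ^ 2 | frameFiltration X n (i + 1)]
      =ᵐ[μ] fun x => oneStepVar (posteriorKernel μ) (n - (i + 1)) φ (frestrictLe (n - (i + 1)) x) := by
  have h := condExp_incr_sq_frame_ae_eq (κ := posteriorKernel μ) (μ.map (fun x => x 0)) n hφm hφR hi
  rwa [trajMeasure_posteriorKernel_eq μ] at h

/-- [folklore] **END-TO-END FOR AN ARBITRARY FINITE PATH LAW** (the lineage's integrated random-geometry bound with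
NO realisation hypothesis left): `μ` a finite measure on `Π n, X n` (standard Borel, non-empty carriers), `φ` a
bounded (`|φ| ≤ R`) observable of the levels `≤ n`, `|t|·2R ≤ 1`, `g₀` a bounded non-negative endpoint observable.
Then for every budget `B`:
`∫ g₀(x 0) e^{tφ} dμ ≤ e^{t²B}·∫ g₀(x 0) e^{t·towerMean (posteriorKernel μ) φ (x 0)} dμ
   + e^{|t|R}·Cg·μ{x ∣ B < Σ_{b<n} oneStepVar (posteriorKernel μ) b φ (x≤b)}`,
where `towerMean (posteriorKernel μ) φ (x 0) = μ[φ ∣ piLE 0]` a.e. (`condExp_piLE_ae_eq_fiberMean_posteriorKernel`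
with `b = 0`) is the UNDRESSED conditional mean given the endpoint and `oneStepVar (posteriorKernel μ) b φ h` is the
one-step conditional variance of the conditional means of `φ` under the posterior law of level `b+1` given the
history `h`.  For the printed chain: the fluctuation half of NE1′ is EXACTLY a `μ`-uniform tail bound for the
accumulated posterior one-step variances (record MI-F1-K); nothing else remains of the probabilistic frame. -/
theorem integral_mul_exp_le_condVar_of_pathLaw (μ : Measure (Π n, X n)) [IsFiniteMeasure μ] (n : ℕ)
    {φ : (Π k, X k) → ℝ} (hφn : StronglyMeasurable[piLE (X := X) n] φ) {R : ℝ} (hφR : ∀ x, |φ x| ≤ R)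
    {t : ℝ} (ht : |t| * (2 * R) ≤ 1) (B : ℝ) {g₀ : X 0 → ℝ} (hg : StronglyMeasurable g₀)
    (hg0 : ∀ z, 0 ≤ g₀ z) {Cg : ℝ} (hgC : ∀ z, g₀ z ≤ Cg) :
    ∫ x, g₀ (x 0) * Real.exp (t * φ x) ∂μ ≤
      Real.exp (t ^ 2 * B) * ∫ x, g₀ (x 0) * Real.exp (t * towerMean (posteriorKernel μ) φ (x 0)) ∂μ +
        Real.exp (|t| * R) * (Cg * μ.real
          {x | B < ∑ b ∈ range n, oneStepVar (posteriorKernel μ) b φ (frestrictLe b x)}) := by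
  have hφm : StronglyMeasurable φ := hφn.mono ((piLE (X := X)).le n)
  have h := integral_mul_exp_le_condVar (κ := posteriorKernel μ) (μ.map (fun x => x 0)) n hφn hφR ht B hg hg0 hgC
  rw [trajMeasure_posteriorKernel_eq μ] at h
  have hGm : AEStronglyMeasurable (fun z : X 0 => g₀ z * Real.exp (t * towerMean (posteriorKernel μ) φ z))
      (μ.map (fun x => x 0)) :=
    (Measurable.mul (f := g₀) (g := fun z => Real.exp (t * towerMean (posteriorKernel μ) φ z)) hg.measurable
      (Real.measurable_exp.comp
        ((stronglyMeasurable_towerMean (κ := posteriorKernel μ) hφm).measurable.const_mul t))).aestronglyMeasurable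
  rwa [integral_map (measurable_pi_apply 0).aemeasurable hGm] at h

/-- [folklore] **WITH PER-HISTORY VARIANCE MAJORANTS** (the consumable form MI-F1-K (K-var) for an arbitrary path
law): measurable `W b` with `|W b h| ≤ Vmax` and `oneStepVar (posteriorKernel μ) b φ h ≤ W b h` for `b < n` give the
same bound with the tail event `{B < Σ_{b<n} W b (x≤b)}`. -/
theorem integral_mul_exp_le_of_oneStepVar_of_pathLaw (μ : Measure (Π n, X n)) [IsFiniteMeasure μ] (n : ℕ)
    {φ : (Π k, X k) → ℝ} (hφn : StronglyMeasurable[piLE (X := X) n] φ) {R : ℝ} (hφR : ∀ x, |φ x| ≤ R)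
    {W : (b : ℕ) → (Π i : Iic b, X i) → ℝ} (hWm : ∀ b, StronglyMeasurable (W b)) {Vmax : ℝ}
    (hWb : ∀ b < n, ∀ h, |W b h| ≤ Vmax) (hW : ∀ b < n, ∀ h, oneStepVar (posteriorKernel μ) b φ h ≤ W b h)
    {t : ℝ} (ht : |t| * (2 * R) ≤ 1) (B : ℝ) {g₀ : X 0 → ℝ} (hg : StronglyMeasurable g₀)
    (hg0 : ∀ z, 0 ≤ g₀ z) {Cg : ℝ} (hgC : ∀ z, g₀ z ≤ Cg) :
    ∫ x, g₀ (x 0) * Real.exp (t * φ x) ∂μ ≤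
      Real.exp (t ^ 2 * B) * ∫ x, g₀ (x 0) * Real.exp (t * towerMean (posteriorKernel μ) φ (x 0)) ∂μ +
        Real.exp (|t| * R) * (Cg * μ.real {x | B < ∑ b ∈ range n, W b (frestrictLe b x)}) := by
  have hφm : StronglyMeasurable φ := hφn.mono ((piLE (X := X)).le n)
  have h := integral_mul_exp_le_of_oneStepVar (κ := posteriorKernel μ) (μ.map (fun x => x 0)) n hφn hφR hWm
    hWb hW ht B hg hg0 hgC
  rw [trajMeasure_posteriorKernel_eq μ] at h
  have hGm : AEStronglyMeasurable (fun z : X 0 => g₀ z * Real.exp (t * towerMean (posteriorKernel μ) φ z))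
      (μ.map (fun x => x 0)) :=
    (Measurable.mul (f := g₀) (g := fun z => Real.exp (t * towerMean (posteriorKernel μ) φ z)) hg.measurable
      (Real.measurable_exp.comp
        ((stronglyMeasurable_towerMean (κ := posteriorKernel μ) hφm).measurable.const_mul t))).aestronglyMeasurable
  rwa [integral_map (measurable_pi_apply 0).aemeasurable hGm] at h

end Posterior

end

end Literature.MathematicalPhysics.QuantumFieldTheory.Balaban1983to89.T4CouplingChain
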